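import Literature.AlgebraicGeometry.AbelianSchemes.PolarizedTripleRigidityOfFibre
import Literature.AlgebraicGeometry.HodgeTheory.AbelianVarietyPolarizedAutomorphismRigidity
import Literature.AlgebraicGeometry.HodgeTheory.ConjugateComplexPoints
import Literature.FieldTheory.AlgClosed.EmbeddingIntoComplex
import HarnessLib

/-!
# TRIPLES ARE RIGID: a polarised abelian scheme of type `δ` with symplectic level-`N` structure, `N ≥ 3`, over a locally
# Noetherian base locally of finite type over a countable field of characteristic `0` has no automorphisms
# ([Deligne1971TravauxShimura, 4.16]; [MumfordFogartyKirwan1994, Ch. 7 §3 p. 139 «lemma of Serre»]; [Milne1986AbelianVarieties,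
# Prop. 17.5]) — UNCONDITIONAL

Capstone of the «triples are rigid» chain of cell hodgecm-mathlib (F-DAG leaf F-7 (7b) / F-8 (8e); seats B-p03 (g17) (L1),
(L2a), this file, and B-p11 (g16) (L2b)).  [Deligne1971TravauxShimura, 4.16 (p. 150)]: «Pour `n ≥ 3`, les objets classifiés n'ont
plus d'automorphismes»; [MumfordFogartyKirwan1994, p. 139]: Theorem 7.9 holds for `n ≥ 3` «using the so-called "lemma of Serre"».
Assembly, BY NAME:

* ★ (L2b) `HodgeTheory.AbelianVariety.forall_iso_hom_eq_id_of_three_le` (B-p11 (g16); uniformisation, Appell–Humbert,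
  «`Aut(X, H)` finite», Minkowski): the field brick over `ℂ`;
* ★ (L2a) `rigid_of_forall_abelianVariety`: the field brick over `Ω` ⇒ triples over `Spec Ω` are rigid;
* ★ (L1) `rigid_of_rigid_extension`: rigidity over `Spec L` descends along any `K →+* L`, and ★ (L2a §3)
  `eq_id_and_hat_eq_id_of_forall_residueField`: rigidity over the residue fields of the total space spreads to the base;
* ★ `FieldTheory.AlgClosed.nonempty_ringHom_complex_of_cardinalMk_le_continuum` (every field of characteristic `0` and
  cardinality `≤ 𝔠` embeds in `ℂ`) and ★ `HodgeTheory.cardinalMk_residueField_le_aleph0` (residue fields of a scheme locally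
  of finite type over a countable field are countable).

Results (all over `Scheme.{0}`, the universe of `ℂ`):
* `eq_id_of_isBaseChangeVia_id_complex` — triples over `Spec ℂ` are rigid (`N ≥ 3`);
* `eq_id_of_isBaseChangeVia_id_of_ringHom_complex` / `…_of_cardinalMk_le_continuum` — over `Spec K`, `K ↪ ℂ` / `#K ≤ 𝔠`;
* `eq_id_and_hat_eq_id_of_residueField_le_continuum` — over a locally Noetherian `S` whose total-space residue fields have
  characteristic `0` and cardinality `≤ 𝔠`;
* **`eq_id_and_hat_eq_id_of_locallyOfFiniteType`** — over a locally Noetherian `S` locally of finite type over a field `F`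
  of characteristic `0` with `#F ≤ ℵ₀` (e.g. `ℚ`): EVERY automorphism `(G, Ĝ)` of a triple is `(𝟙, 𝟙)`;
* **`IsBaseChangeVia.unique_of_locallyOfFiniteType`** — hence pull-back data `(G, Ĝ)` of triples along any `f : T → S` with
  such a `T` are UNIQUE (the isomorphisms of `classify` are unique; local isomorphisms of triples glue —
  [MumfordFogartyKirwan1994] Prop. 7.6).
The remaining generality (test schemes with residue fields of cardinality `> 𝔠`) is the descent layer (L3), not needed for
bases of finite type over `ℚ`.

Theorems only (no definition, no named fact, no instance, no `sorry`).  HC_CM is proved only modulo the 7 printed citations until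
rung 0 closes; this file discharges none of them.

## References
* [Deligne1971TravauxShimura] P. Deligne, Travaux de Shimura, Sém. Bourbaki 389 (1971), 4.16 (p. 150).
* [MumfordFogartyKirwan1994] D. Mumford, J. Fogarty, F. Kirwan, *Geometric Invariant Theory*, 3rd ed. (1994), Ch. 7 §2
  Prop. 7.6 (pp. 136–138); §3, remark after Thm. 7.9 (p. 139).
* [Milne1986AbelianVarieties] J. S. Milne, Abelian varieties, in Cornell–Silverman (1986), Prop. 17.5 (p. 139).
-/

set_option autoImplicit false

noncomputable section

open CategoryTheory CategoryTheory.Limits AlgebraicGeometry Cardinal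

namespace Literature.AlgebraicGeometry.AbelianSchemes

namespace PolarizedAbelianSchemeWithLevel

variable {g N : ℕ} {δ : Fin g → ℕ}

/-! ### §1 Over `Spec ℂ` -/

/-- **Triples over `Spec ℂ` are rigid** (`N ≥ 3`): every automorphism `(H, Ĥ)` of a polarised abelian scheme of type `δ` with
level-`N` structure over `Spec ℂ` has `H = 𝟙` — ★ (L2a) fed with ★ (L2b). [cite: Deligne1971TravauxShimura, 4.16 p. 150]
[cite: Milne1986AbelianVarieties, Prop. 17.5 (b) (p. 139)] -/
theorem eq_id_of_isBaseChangeVia_id_complex (hN : 3 ≤ N) (Q : PolarizedAbelianSchemeWithLevel g N δ (Spec (.of ℂ)))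
    {H : Q.A.X.left ⟶ Q.A.X.left} {Ĥ : Q.D.hat.X.left ⟶ Q.D.hat.X.left} (h : Q.IsBaseChangeVia Q (𝟙 _) H Ĥ) :
    H = 𝟙 Q.A.X.left :=
  rigid_of_forall_abelianVariety (HodgeTheory.AbelianVariety.forall_iso_hom_eq_id_of_three_le hN) Q h

/-! ### §2 Over fields embeddable in `ℂ` -/

/-- **Triples over `Spec K` are rigid for every field `K` with a ring map to `ℂ`** (★ `rigid_of_rigid_extension`).
[cite: Deligne1971TravauxShimura, 4.16 p. 150] [cite: MumfordFogartyKirwan1994, Ch. 7 §3, remark after Theorem 7.9 (p. 139)] -/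
theorem eq_id_of_isBaseChangeVia_id_of_ringHom_complex {K : Type} [Field K] (i : K →+* ℂ) (hN : 3 ≤ N)
    (Q : PolarizedAbelianSchemeWithLevel g N δ (Spec (.of K))) {H : Q.A.X.left ⟶ Q.A.X.left}
    {Ĥ : Q.D.hat.X.left ⟶ Q.D.hat.X.left} (h : Q.IsBaseChangeVia Q (𝟙 _) H Ĥ) : H = 𝟙 Q.A.X.left :=
  rigid_of_rigid_extension i (fun Q' _ _ h' => eq_id_of_isBaseChangeVia_id_complex hN Q' h') Q H Ĥ h

/-- **Triples over `Spec K` are rigid for every field `K` of characteristic `0` with `#K ≤ 𝔠`** (such a field embeds in `ℂ`,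
★ `FieldTheory.AlgClosed.nonempty_ringHom_complex_of_cardinalMk_le_continuum`). [cite: Deligne1971TravauxShimura, 4.16 p. 150]
[cite: MumfordFogartyKirwan1994, Ch. 7 §3, remark after Theorem 7.9 (p. 139)] -/
theorem eq_id_of_isBaseChangeVia_id_of_cardinalMk_le_continuum {K : Type} [Field K] [CharZero K] (hK : #K ≤ 𝔠)
    (hN : 3 ≤ N) (Q : PolarizedAbelianSchemeWithLevel g N δ (Spec (.of K))) {H : Q.A.X.left ⟶ Q.A.X.left}
    {Ĥ : Q.D.hat.X.left ⟶ Q.D.hat.X.left} (h : Q.IsBaseChangeVia Q (𝟙 _) H Ĥ) : H = 𝟙 Q.A.X.left := by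
  obtain ⟨i⟩ := Literature.FieldTheory.AlgClosed.nonempty_ringHom_complex_of_cardinalMk_le_continuum K hK
  exact eq_id_of_isBaseChangeVia_id_of_ringHom_complex i hN Q h

/-! ### §3 Over locally Noetherian bases with small residue fields -/

/-- **Every automorphism of a triple over a locally Noetherian base is trivial as soon as the residue fields of the total space
have characteristic `0` and cardinality `≤ 𝔠`** (★ `eq_id_and_hat_eq_id_of_forall_residueField` + §2).
[cite: MumfordFogartyKirwan1994, Ch. 6 §1 Corollary 6.2 (p. 116); Ch. 7 §3, remark after Theorem 7.9 (p. 139)] -/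
theorem eq_id_and_hat_eq_id_of_residueField_le_continuum {S : Scheme.{0}} [IsLocallyNoetherian S]
    (P : PolarizedAbelianSchemeWithLevel g N δ S) (hN : 3 ≤ N)
    (hκ : ∀ z : ↥P.A.X.left, CharZero (P.A.X.left.residueField z) ∧ #(P.A.X.left.residueField z) ≤ 𝔠)
    {G : P.A.X.left ⟶ P.A.X.left} {Ĝ : P.D.hat.X.left ⟶ P.D.hat.X.left} (h : P.IsBaseChangeVia P (𝟙 S) G Ĝ) :
    G = 𝟙 P.A.X.left ∧ Ĝ = 𝟙 P.D.hat.X.left :=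
  P.eq_id_and_hat_eq_id_of_forall_residueField
    (fun z Q _ _ hQ => by
      haveI := (hκ z).1
      exact eq_id_of_isBaseChangeVia_id_of_cardinalMk_le_continuum (hκ z).2 hN Q hQ) h

/-! ### §4 Over bases locally of finite type over a countable field of characteristic `0` — the form `classify` consumes -/

/-- The residue fields of a scheme over a field of characteristic `0` have characteristic `0` (a copy of ★
`Resolution.charZero_residueField_of_over_field`, inlined to keep the resolution-of-singularities files out of the import
closure). [folklore] -/
private theorem charZero_residueField {k : Type} [Field k] [CharZero k] {X : Scheme.{0}} (f : X ⟶ Spec (.of k)) (x : X) :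
    CharZero (X.residueField x) := by
  let e : k ≃+* Γ(Spec (.of k), ⊤) := (Scheme.ΓSpecIso (.of k)).commRingCatIsoToRingEquiv.symm
  let φ : k →+* X.residueField x := (X.evaluation ⊤ x trivial).hom.comp ((f.appTop).hom.comp e.toRingHom)
  exact (RingHom.charZero_iff φ.injective).mp inferInstance

/-- **TRIPLES ARE RIGID** ([Deligne1971TravauxShimura] 4.16 «pour `n ≥ 3` les objets classifiés n'ont plus d'automorphismes»;
[MumfordFogartyKirwan1994] p. 139): over a locally Noetherian base `S` locally of finite type over a field `F` of characteristic `0`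
with `#F ≤ ℵ₀` (e.g. `ℚ`, or any number field), every automorphism `(G, Ĝ)` of a polarised abelian scheme of type `δ` with
symplectic-liftable level-`N` structure, `N ≥ 3`, is `(𝟙, 𝟙)` — UNCONDITIONALLY.  The residue fields of the total space
`X → S → Spec F` (locally of finite type: `X → S` is proper) are countable (★ `cardinalMk_residueField_le_aleph0`) of
characteristic `0`, so §3 applies. [cite: Deligne1971TravauxShimura, 4.16 p. 150] [cite: MumfordFogartyKirwan1994, Ch. 7 §3, remark after Theorem 7.9 (p. 139)]
[cite: Milne1986AbelianVarieties, Prop. 17.5 (p. 139)] -/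
theorem eq_id_and_hat_eq_id_of_locallyOfFiniteType {F : Type} [Field F] [CharZero F] (hF : #F ≤ ℵ₀) {S : Scheme.{0}}
    [IsLocallyNoetherian S] (f : S ⟶ Spec (.of F)) [LocallyOfFiniteType f] (P : PolarizedAbelianSchemeWithLevel g N δ S)
    (hN : 3 ≤ N) {G : P.A.X.left ⟶ P.A.X.left} {Ĝ : P.D.hat.X.left ⟶ P.D.hat.X.left} (h : P.IsBaseChangeVia P (𝟙 S) G Ĝ) :
    G = 𝟙 P.A.X.left ∧ Ĝ = 𝟙 P.D.hat.X.left := by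
  haveI := P.A.isProper
  haveI : LocallyOfFiniteType (P.A.X.hom ≫ f) := inferInstance
  exact P.eq_id_and_hat_eq_id_of_residueField_le_continuum hN
    (fun z => ⟨charZero_residueField (P.A.X.hom ≫ f) z,
      (HodgeTheory.cardinalMk_residueField_le_aleph0 P.A.X.left (P.A.X.hom ≫ f) hF z).trans aleph0_le_continuum⟩) h

/-- **Hence PULL-BACK DATA OF TRIPLES ARE UNIQUE over such bases** ([MumfordFogartyKirwan1994] Prop. 7.6: the isomorphisms
of `classify` are unique, so local isomorphisms of triples glue): if `(G₁, Ĝ₁)` and `(G₂, Ĝ₂)` both exhibit `P′` over `T` as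
the pull-back of `P` over `S` along the same `f : T → S`, with `T` locally Noetherian and locally of finite type over a
countable field of characteristic `0` and `N ≥ 3`, then `G₁ = G₂` and `Ĝ₁ = Ĝ₂`.
[cite: MumfordFogartyKirwan1994, Ch. 7 §2 Proposition 7.6 (pp. 136–138); §3, remark after Theorem 7.9 (p. 139)]
[cite: Deligne1971TravauxShimura, 4.16 p. 150] -/
theorem IsBaseChangeVia.unique_of_locallyOfFiniteType {F : Type} [Field F] [CharZero F] (hF : #F ≤ ℵ₀)
    {S T : Scheme.{0}} [IsLocallyNoetherian T] (fT : T ⟶ Spec (.of F)) [LocallyOfFiniteType fT]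
    {P : PolarizedAbelianSchemeWithLevel g N δ S} {P' : PolarizedAbelianSchemeWithLevel g N δ T} (hN : 3 ≤ N)
    {f : T ⟶ S} {G₁ G₂ : P'.A.X.left ⟶ P.A.X.left} {Ĝ₁ Ĝ₂ : P'.D.hat.X.left ⟶ P.D.hat.X.left}
    (h₁ : P'.IsBaseChangeVia P f G₁ Ĝ₁) (h₂ : P'.IsBaseChangeVia P f G₂ Ĝ₂) : G₁ = G₂ ∧ Ĝ₁ = Ĝ₂ := by
  obtain ⟨K, Kd, -, -, hKG, hKdG, hK⟩ := h₁.exists_isBaseChangeVia_id_of_isBaseChangeVia h₂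
  obtain ⟨hK1, hKd1⟩ := eq_id_and_hat_eq_id_of_locallyOfFiniteType hF fT P' hN hK
  rw [hK1, Category.id_comp] at hKG
  rw [hKd1, Category.id_comp] at hKdG
  exact ⟨hKG, hKdG⟩

/-- **Over `ℚ`-schemes of finite type** (the case of the fine moduli functor's test category restricted to finite type and of
F-10's base `A_{g,δ,NK}`): `#ℚ = ℵ₀`, so every automorphism of a triple over a locally Noetherian `S` locally of finite type
over `Spec ℚ` is trivial, `N ≥ 3`. [cite: Deligne1971TravauxShimura, 4.16 p. 150] [cite: MumfordFogartyKirwan1994, Ch. 7 §3, remark after Theorem 7.9 (p. 139)] -/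
theorem eq_id_and_hat_eq_id_of_locallyOfFiniteType_rat {S : Scheme.{0}} [IsLocallyNoetherian S]
    (f : S ⟶ Spec (.of ℚ)) [LocallyOfFiniteType f] (P : PolarizedAbelianSchemeWithLevel g N δ S) (hN : 3 ≤ N)
    {G : P.A.X.left ⟶ P.A.X.left} {Ĝ : P.D.hat.X.left ⟶ P.D.hat.X.left} (h : P.IsBaseChangeVia P (𝟙 S) G Ĝ) :
    G = 𝟙 P.A.X.left ∧ Ĝ = 𝟙 P.D.hat.X.left :=
  eq_id_and_hat_eq_id_of_locallyOfFiniteType (F := ℚ) (by rw [Cardinal.mk_eq_aleph0]) f P hN h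

end PolarizedAbelianSchemeWithLevel

end Literature.AlgebraicGeometry.AbelianSchemes

end
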